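import Summits.HubbardSuperconductivity.HubbardSuperconductivity.Theorems.AnisotropyChordTransferGapScale
import Summits.HubbardSuperconductivity.HubbardSuperconductivity.Theorems.AnisotropyChordTransferCompressibilityKR

/-!
# Route `AnisotropyChord` / H0 rotor rung, route (1): HYPOTHESIS F AND THE COMPRESSIBILITY CHAIN ON THE REPULSIVE SIDE `Δ ≤ 0`,
# anchor-free on the certified window `−0.15 ≤ Δ ≤ 0` (prover seat `hubbard-h0-rotor-p1` g15)

`hopCorr_perron_ge` / `fsumLower_holds` (`…TransferFsumBound`) were stated for `0 ≤ Δ`.  The same variational argument with the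
uniform sector state gives, for `Δ ≤ 0` (nearest-neighbour REPULSION), `h₀ ≥ (1−Δ)·(V²/2 − 2M²)/(V(V−1)) + Δ` (the Ising term now
enters with `brkMass ≤ 1` on each of the `D` directed bonds), positive for `|Δ| < m̄ /(1 − m̄)`, in particular on `−1/4 ≤ Δ ≤ 0` near
half filling:

* `hopCorr_perron_ge_of_nonpos`, `fsumLower_holds_of_nonpos`, **`fsumLower_eventually_of_nonpos`**
  (`−1/4 ≤ Δ ≤ 0 → ∀ k, ∀ᶠ L, ∀ |j| ≤ k+1, FsumLower L Δ j (7/32)`);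
* **`condensate_repulsive_of_compressibility_KR`** — on `−0.15 ≤ Δ ≤ 0`: compressibility K + `k = 0` Feynman saturation R₀ (uniform
  `κ > 0`, `c_s > 0` on `|j| ≤ k+1`, eventually in `L`) ⇒ `CondensateOnFirstSectors Δ k`, with NO anchor hypothesis
  (`halfFillingAnchor_of_repulsive`) and NO f-sum hypothesis — the compressibility currency of THEOREM T for hard-core bosons with
  nearest-neighbour repulsion, conditional on K ∧ R₀ only.

All folklore (variational principle + exchangeability; lattice f-sum rule).
-/

set_option linter.dupNamespace false
set_option autoImplicit false

noncomputable section

open Finset Filter Topology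
open Literature.MathematicalPhysics.QuantumLattice Literature.Probability.LatticeModels
open Summit.HubbardSuperconductivity.HubbardSuperconductivity.Theorems.AnisotropyChord.InsertionEntropy
open Summit.HubbardSuperconductivity.HubbardSuperconductivity.Theorems.AnisotropyChord.Tower

namespace Summit.HubbardSuperconductivity.HubbardSuperconductivity.Theorems.AnisotropyChord.Transfer

variable {L : ℕ} [NeZero L]
set_option maxHeartbeats 400000 in
/-- **exchange correlation bounded below, repulsive side:** for a Perron sector amplitude of `H(Δ)` with `Δ ≤ 0` and `L ≥ 2`,
`hopCorr a 0 e₀ ≥ (1−Δ)·(V²/2 − 2M²)/(V(V−1)) + Δ`, `V = L²`. [folklore] -/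
theorem hopCorr_perron_ge_of_nonpos {Δ M : ℝ} {a : TensorIndex (TorusSite 2 L) 2 → ℝ}
    (ha : IsPerronSectorGroundAmplitude L Δ M a) (hL : 2 ≤ L) (hΔ : Δ ≤ 0) :
    (1 - Δ) * ((((L : ℝ) ^ 2) ^ 2 / 2 - 2 * M ^ 2) / ((L : ℝ) ^ 2 * ((L : ℝ) ^ 2 - 1))) + Δ
      ≤ hopCorr a 0 (Pi.single 0 1) := by
  obtain ⟨n, hnV, hn⟩ := perron_natSector ha
  set V : ℕ := Fintype.card (TorusSite 2 L) with hVdef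
  have hVL : (V : ℝ) = (L : ℝ) ^ 2 := by
    have hcardT : Fintype.card (TorusSite 2 L) = L ^ 2 := by rw [Fintype.card_fun, ZMod.card, Fintype.card_fin]
    rw [hVdef, hcardT]; push_cast; ring
  have hV4 : (4 : ℝ) ≤ V := by
    rw [hVL]; have : (2 : ℝ) ≤ L := by exact_mod_cast hL
    nlinarith
  set m : ℕ := V - n with hmdef
  have hmV : (m : ℝ) = (V : ℝ) - n := by rw [hmdef]; push_cast [Nat.cast_sub hnV]; ring
  have hm : ((V : ℝ) - (m : ℝ)) = (V : ℝ) / 2 + M := by rw [hmV, ← hn]; ring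
  set D : ℝ := ∑ x : TorusSite 2 L, ∑ y, if (torusGraph 2 L).Adj x y then (1:ℝ) else 0 with hD
  set P : ℝ := ((Stiffness.Exch.sector (TorusSite 2 L) m).card : ℝ) with hP
  set Sm : ℝ := ∑ x : TorusSite 2 L, ∑ y, if (torusGraph 2 L).Adj x y then brkMass a x y else 0 with hSm
  set h₀ : ℝ := hopCorr a 0 (Pi.single 0 1) with hh₀
  have hDpos : 0 < D := edgeCount_pos hL
  set A₀ : ℝ := (Stiffness.Exch.A m (0 : TorusSite 2 L) ((0 : TorusSite 2 L) + Pi.single 0 1) : ℝ) with hA₀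
  have hne0 : (0 : TorusSite 2 L) ≠ 0 + Pi.single 0 1 := (Stiffness.add_single_ne_self hL 0 0).symm
  have hAconst : ∀ x y : TorusSite 2 L, (torusGraph 2 L).Adj x y → (Stiffness.Exch.A m x y : ℝ) = A₀ := by
    intro x y hxy
    rw [hA₀]; exact_mod_cast Stiffness.Exch.A_const m hxy.ne hne0
  have hAcount : (V : ℝ) * ((V : ℝ) - 1) * A₀ = (n : ℝ) * ((V : ℝ) - n) * P := by
    have h := Stiffness.Exch.card_card_pred_mul_A (α := TorusSite 2 L) m hne0
    have h' : ((Fintype.card (TorusSite 2 L) : ℕ) : ℝ) * (((Fintype.card (TorusSite 2 L) - 1 : ℕ)) : ℝ) * A₀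
        = (m : ℝ) * (((Fintype.card (TorusSite 2 L) - m : ℕ)) : ℝ) * P := by
      rw [hA₀, hP]; exact_mod_cast h
    have h1V : 1 ≤ V := le_trans (by norm_num) (by exact_mod_cast (le_trans hV4 le_rfl : (4:ℝ) ≤ V) : 4 ≤ V)
    rw [← hVdef, Nat.cast_sub h1V, Nat.cast_sub (Nat.sub_le V n)] at h'
    rw [hmV] at h'
    push_cast at h'
    linear_combination h'
  have hSh : (∑ x : TorusSite 2 L, ∑ y, if (torusGraph 2 L).Adj x y then (brkMass a x y - hopCorr a x y) else 0)
      = Sm - h₀ * D := by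
    rw [hSm, hD, Finset.mul_sum, ← Finset.sum_sub_distrib]
    refine Finset.sum_congr rfl fun x _ => ?_
    rw [Finset.mul_sum, ← Finset.sum_sub_distrib]
    refine Finset.sum_congr rfl fun y _ => ?_
    by_cases hxy : (torusGraph 2 L).Adj x y
    · rw [if_pos hxy, if_pos hxy, if_pos hxy, hopCorr_perron_adj ha hxy, ← hh₀]; ring
    · rw [if_neg hxy, if_neg hxy, if_neg hxy]; ring
  have hSA : (∑ x : TorusSite 2 L, ∑ y, if (torusGraph 2 L).Adj x y then (2 * (Stiffness.Exch.A m x y : ℝ)) else 0)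
      = 2 * A₀ * D := by
    rw [hD, Finset.mul_sum]
    refine Finset.sum_congr rfl fun x _ => ?_
    rw [Finset.mul_sum]
    refine Finset.sum_congr rfl fun y _ => ?_
    by_cases hxy : (torusGraph 2 L).Adj x y
    · rw [if_pos hxy, if_pos hxy, hAconst x y hxy]; ring
    · rw [if_neg hxy, if_neg hxy]; ring
  -- NEW on the repulsive side: the broken-bond mass is at most the number of bonds
  have hSmD : Sm ≤ D := by
    rw [hSm, hD]
    refine Finset.sum_le_sum fun x _ => Finset.sum_le_sum fun y _ => ?_
    split_ifs
    · have := brkMass_le_sum_sq a x y; rw [ha.unit] at this; exact this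
    · exact le_rfl
  have hE := perron_energy_bond_sum ha
  rw [hSh] at hE
  have hU := sectorE_le_uniform (L := L) (Δ := Δ) (M := M) m hm
  rw [hSA, ← hE] at hU
  have hP0 : 0 ≤ P := by rw [hP]; positivity
  -- from hU:  h₀ D P ≥ Δ Sm P + 2(1−Δ) A₀ D ≥ Δ D P + 2(1−Δ) A₀ D   (Δ ≤ 0, Sm ≤ D)
  have hΔSm : Δ * D * P ≤ Δ * Sm * P := by
    have := mul_le_mul_of_nonpos_left hSmD hΔ
    nlinarith [this, hP0]
  have hkey : 2 * (1 - Δ) * A₀ * D + Δ * D * P ≤ h₀ * D * P := by nlinarith [hU, hΔSm]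
  have hkey' : 2 * (1 - Δ) * A₀ + Δ * P ≤ h₀ * P := by
    have : (2 * (1 - Δ) * A₀ + Δ * P) * D ≤ h₀ * P * D := by nlinarith [hkey]
    exact le_of_mul_le_mul_right this hDpos
  -- P > 0
  have hPpos : 0 < P := by
    obtain ⟨σ₀, hσ₀⟩ : ∃ σ₀, a σ₀ ≠ 0 := by
      by_contra hall; push Not at hall
      have : ∑ σ, a σ ^ 2 = 0 := Finset.sum_eq_zero fun σ _ => by rw [hall σ]; ring
      rw [ha.unit] at this; exact one_ne_zero this
    have hz := perron_support ha σ₀ hσ₀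
    rw [zerosCard_eq_card_sub_occ, ← hVdef] at hz
    have hocc : Stiffness.Exch.occ σ₀ = m := by
      have h1 : (Stiffness.Exch.occ σ₀ : ℝ) = (m : ℝ) := by rw [hmV]; linarith [hm]
      exact_mod_cast h1
    have hmem : σ₀ ∈ Stiffness.Exch.sector (TorusSite 2 L) m := by
      unfold Stiffness.Exch.sector; rw [Finset.mem_filter]; exact ⟨Finset.mem_univ _, hocc⟩
    rw [hP]; exact_mod_cast Finset.card_pos.2 ⟨σ₀, hmem⟩
  have hVV : 0 < (V : ℝ) * ((V : ℝ) - 1) := by nlinarith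
  rw [← hVL]
  have hnum : ((V : ℝ) ^ 2 / 2 - 2 * M ^ 2) = 2 * ((n : ℝ) * ((V : ℝ) - n)) := by
    have : (n : ℝ) = (V : ℝ) / 2 + M := hn
    rw [this]; ring
  rw [hnum]
  -- (1−Δ)·2n(V−n)/(V(V−1)) = 2(1−Δ)A₀/P
  have hfrac : (1 - Δ) * (2 * ((n : ℝ) * ((V : ℝ) - n)) / ((V : ℝ) * ((V : ℝ) - 1))) = 2 * (1 - Δ) * A₀ / P := by
    rw [eq_div_iff hPpos.ne']
    have e1 : 2 * ((n : ℝ) * ((V : ℝ) - n)) / ((V : ℝ) * ((V : ℝ) - 1)) * P = 2 * A₀ := by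
      rw [div_mul_eq_mul_div, div_eq_iff hVV.ne']
      linear_combination (-2 : ℝ) * hAcount
    calc (1 - Δ) * (2 * ((n : ℝ) * ((V : ℝ) - n)) / ((V : ℝ) * ((V : ℝ) - 1))) * P
        = (1 - Δ) * (2 * ((n : ℝ) * ((V : ℝ) - n)) / ((V : ℝ) * ((V : ℝ) - 1)) * P) := by ring
      _ = (1 - Δ) * (2 * A₀) := by rw [e1]
      _ = 2 * (1 - Δ) * A₀ := by ring
  rw [hfrac]
  have : 2 * (1 - Δ) * A₀ / P + Δ = (2 * (1 - Δ) * A₀ + Δ * P) / P := by field_simp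
  rw [this, div_le_iff₀ hPpos]
  linarith [hkey']

/-- **HYPOTHESIS F on the repulsive side (exact constant):** for `L ≥ 3` and `Δ ≤ 0`,
`FsumLower L Δ M ((1−Δ)(L⁴/2 − 2M²)/(L²(L²−1)) + Δ)`. [folklore] -/
theorem fsumLower_holds_of_nonpos {Δ M : ℝ} (hL : 3 ≤ L) (hΔ : Δ ≤ 0) :
    FsumLower L Δ M ((1 - Δ) * ((((L : ℝ) ^ 2) ^ 2 / 2 - 2 * M ^ 2) / ((L : ℝ) ^ 2 * ((L : ℝ) ^ 2 - 1))) + Δ) := by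
  intro a ha
  have hL2 : 2 ≤ L := le_trans (by norm_num) hL
  have hcard : (Fintype.card (TorusSite 2 L) : ℝ) = (L : ℝ) ^ 2 := by
    have hcardT : Fintype.card (TorusSite 2 L) = L ^ 2 := by rw [Fintype.card_fun, ZMod.card, Fintype.card_fin]
    rw [hcardT]; push_cast; ring
  have hLpos : (0 : ℝ) < L := by exact_mod_cast (by omega : 0 < L)
  rw [hcard, mul_div_assoc, div_self (by positivity), mul_one]
  exact le_trans (hopCorr_perron_ge_of_nonpos ha hL2 hΔ) (hopCorr_le_fsumC ha hL)

/-- **HYPOTHESIS F with the uniform constant `7/32` on `−1/4 ≤ Δ ≤ 0`** (sectors `16M² ≤ L⁴`, `L ≥ 3`). [folklore] -/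
theorem fsumLower_of_nonpos_uniform {Δ M : ℝ} (hL : 3 ≤ L) (hΔm : -(1/4 : ℝ) ≤ Δ) (hΔ : Δ ≤ 0)
    (hM : 16 * M ^ 2 ≤ ((L : ℝ) ^ 2) ^ 2) : FsumLower L Δ M (7/32) := by
  apply fsumLower_mono _ (fsumLower_holds_of_nonpos hL hΔ)
  have hL3 : (3 : ℝ) ≤ L := by exact_mod_cast hL
  have hV : (9 : ℝ) ≤ (L : ℝ) ^ 2 := by nlinarith
  set V : ℝ := (L : ℝ) ^ 2 with hVdef
  have hVV : 0 < V * (V - 1) := by nlinarith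
  have hX : (3/8 : ℝ) ≤ (V ^ 2 / 2 - 2 * M ^ 2) / (V * (V - 1)) := by
    rw [le_div_iff₀ hVV]; nlinarith
  nlinarith [hX]

/-- **the F-input of the compressibility chain on the repulsive side:** for `−1/4 ≤ Δ ≤ 0` and every `k`, eventually in `L`,
`FsumLower L Δ j (7/32)` on all sectors `|j| ≤ k + 1`. [folklore] -/
theorem fsumLower_eventually_of_nonpos {Δ : ℝ} (hΔm : -(1/4 : ℝ) ≤ Δ) (hΔ : Δ ≤ 0) (k : ℕ) :
    ∀ᶠ L : ℕ in atTop, ∀ [NeZero L], ∀ j : ℤ, |j| ≤ ((k + 1 : ℕ) : ℤ) → FsumLower L Δ (j : ℝ) (7/32) := by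
  filter_upwards [eventually_ge_atTop (2 * (k + 1) + 3)] with L hL
  intro _ j hj
  apply fsumLower_of_nonpos_uniform (by omega) hΔm hΔ
  have hjR : |(j : ℝ)| ≤ (k + 1 : ℝ) := by
    have : (|j| : ℝ) ≤ ((k + 1 : ℕ) : ℝ) := by exact_mod_cast hj
    push_cast at this
    exact this
  have hj2 : (j : ℝ) ^ 2 ≤ ((k : ℝ) + 1) ^ 2 := by
    calc (j : ℝ) ^ 2 = |(j : ℝ)| ^ 2 := (sq_abs _).symm
      _ ≤ ((k : ℝ) + 1) ^ 2 := pow_le_pow_left₀ (abs_nonneg _) hjR 2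
  have hLk : 2 * ((k : ℝ) + 1) ≤ L := by
    have : ((2 * (k + 1) + 3 : ℕ) : ℝ) ≤ L := by exact_mod_cast hL
    push_cast at this; linarith
  have hL2 : (2 : ℝ) ≤ L := by have hk0 : (0 : ℝ) ≤ k := Nat.cast_nonneg _; linarith
  have hL4 : (4 : ℝ) ≤ (L : ℝ) ^ 2 := by nlinarith
  have hsq : (2 * ((k : ℝ) + 1)) ^ 2 ≤ (L : ℝ) ^ 2 := pow_le_pow_left₀ (by positivity) hLk 2
  calc 16 * (j : ℝ) ^ 2 ≤ 16 * ((k : ℝ) + 1) ^ 2 := by linarith [hj2]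
    _ = 4 * (2 * ((k : ℝ) + 1)) ^ 2 := by ring
    _ ≤ 4 * (L : ℝ) ^ 2 := by linarith [hsq]
    _ ≤ (L : ℝ) ^ 2 * (L : ℝ) ^ 2 := by nlinarith [hL4]
    _ = ((L : ℝ) ^ 2) ^ 2 := by ring

/-- **THE COMPRESSIBILITY CURRENCY ON THE REPULSIVE WINDOW, ANCHOR-FREE:** for hard-core bosons with nearest-neighbour repulsion
`−0.15 ≤ Δ ≤ 0`, compressibility K and `k = 0` Feynman saturation R₀ with uniform constants `κ > 0`, `c_s > 0` on the sectors
`|j| ≤ k+1`, eventually in `L`, give `CondensateOnFirstSectors Δ k` (BEC at `N = L²/2 + j`, `j ≤ k`).  Anchor = Kubo–Kishi /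
Wischmann–Müller-Hartmann (`halfFillingAnchor_of_repulsive`), f-sum = `fsumLower_eventually_of_nonpos`, transfer =
`condensateOnFirstSectors_of_symmetricGap_open`. [folklore] -/
theorem condensate_repulsive_of_compressibility_KR {Δ κ cs : ℝ} {k : ℕ} (hΔ : -0.15 ≤ Δ) (hΔ' : Δ ≤ 0)
    (hκ : 0 < κ) (hcs : 0 < cs)
    (h : ∀ᶠ L : ℕ in atTop, ∀ [NeZero L], ∀ j : ℤ, |j| ≤ ((k + 1 : ℕ) : ℤ) →
      DensityResponseBound L Δ (j : ℝ) κ ∧ PhononSaturationBelowSym (L := L) Δ (j : ℝ) cs) :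
    CondensateOnFirstSectors Δ k := by
  obtain ⟨c₀, hc₀, hA⟩ := halfFillingAnchor_of_repulsive Δ hΔ hΔ'
  have hΔm : -(1/4 : ℝ) ≤ Δ := by norm_num at hΔ ⊢; linarith
  have hF := fsumLower_eventually_of_nonpos hΔm hΔ' k
  have hGap : SymmetricSectorGap Δ (cs * Real.sqrt ((7/32 : ℝ) / κ)) (k + 1) := by
    apply symmetricSectorGap_of_compressibility_saturation hκ hcs.le
    filter_upwards [h, hF] with L hL hFL
    intro _ j hj
    obtain ⟨hK, hR⟩ := hL j hj
    exact ⟨hK, hFL j hj, hR⟩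
  have hc₁ : 0 < cs * Real.sqrt ((7/32 : ℝ) / κ) := mul_pos hcs (Real.sqrt_pos.2 (by positivity))
  exact condensateOnFirstSectors_of_symmetricGap_open (by norm_num at hΔ ⊢; linarith) (by linarith) hc₀ hc₁ hA hGap

end Summit.HubbardSuperconductivity.HubbardSuperconductivity.Theorems.AnisotropyChord.Transfer
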